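import Summits.BirchSwinnertonDyer.BirchSwinnertonDyer.Theorems.PrintCf2RamifiedOffTYZLevelTwoHalfGenerator
import Summits.BirchSwinnertonDyer.Rank1Residual.P2.CongruentNumberSilentEvenFiveThetaFourTorsion
import Literature.NumberTheory.EllipticCurves.TianYuanZhang2017.CMPointGaloisDisplays
import Literature.NumberTheory.EllipticCurves.TianYuanZhang2017.CurveAFourTorsion
import Literature.NumberTheory.EllipticCurves.IsogenyLocalPointsMaps
import HarnessLib

/-!
# Route `PrintCf2`, crux stmt-BirchSwinnertonDyer-20509 `RamifiedOffTYZOfFacts` — GALOIS MOTION OF THE GENUS POINT BOUNDS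
# THE `2`-ADIC VALUATION OF `𝓛(n)`: «some `g ∈ Gal(ℍ′_n/K_n(i))` moves `P(n)` ⟹ `4 ∤ 𝓛(n)`», «… and fixes a half of the
# generator ⟹ `𝓛(n)` odd» (cell `bsd-print-cf2`, LEAD of 20509 g4, line `offtyz-v7`, lineage cycle 5; fact-free,
# Theses-free, no `def`)

HONEST FRAMING (crux 20509 = `𝔅_ram → WAllCornerFTwoRamifiedOffTYZProved`, DECIDING, OPEN AS A CLASS): bookkeeping on
Tian–Yuan–Zhang's Theorem 3.5 main clause and Lemma 3.18 taken as HYPOTHESES on the displayed data (`D.thm35Main`,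
`D.scriptLSpec`, `D.lemma318` on `D : GenusPointData n` — the sentences of arXiv:1411.4728 §3 AS PRINTED), GZK by name, the
W2 descent kernel (`stub_S0`, `twist_halving`), g3's ρ-free main clause `2·P(n) ≡ ±𝓛(n)·Q₁` (`…LevelTwoHalfGenerator`), the
explicit `2`-isogeny's Galois-equivariance (`map_twoIsogenyPointsHom`) and the explicit eight points `A[(1+i)³]`
(`CurveAFourTorsion`, cell bsd-monsky's `…ThetaFourTorsion`).  Nothing is asserted; C⁺ = `stub_offTYZ_levelTwoScriptLExact`
stays open.  This is the kernel end of the LEAD note `Cruxes/RamifiedOffTYZOfFacts/Lines/offtyz_v7_TransferLayer.md`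
(§5.2 «criterion», §5.4): there the EXISTENCE of an automorphism moving `P(n)` is computed by class field theory (the
transfer = power map in `Pic(O₂)`, kernel `…GenusPeriodTransfer`, and the 𝔭₂-law); HERE is what such a motion buys.

* §1 `galPt_eq_self_of_isOfFinAddOrder`: for ODD `n`, every torsion point of `A(ℍ′_n)` is fixed by every `g ∈ Aut_ℚ(ℍ′_n)`
  with `g(i) = i` (Lemma 3.18: the torsion is `A[(1+i)³] = A(ℚ(i))`, eight explicit points).
* §2 `galPt_two_smul_half_eq`: if `φ_H(Q₁)` comes from `K_n` (`= ι X`, `X ∈ A₂(K_n)`) and `g(√−n) = √−n`, then `g` fixes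
  `2·Q₁` (Galois-equivariance of `φ`, `ker φ_H = {0, τ(1)}`).
* §3 **`not_four_dvd_of_galPt_genusPoint_ne`**: square-free ODD `n ≡ 5, 7 (mod 8)`, `ord_{s=1} L(E_n, s) = 1`, GZK, `D` with
  Thm 3.5 / integrality / Lemma 3.18: if some `g ∈ Aut_ℚ(ℍ′_n)` fixing `i` and `√−n` MOVES `P(n)`, then **`4 ∤ L` for every
  `L` with `𝓛(n)² = L²`** (if `4 ∣ 𝓛` then `P(n) ≡ c·(2Q₁)` modulo torsion is `g`-fixed).  Contrapositive
  `galPt_genusPoint_eq_of_four_dvd`: **`4 ∣ 𝓛(n)` ⟹ `P(n)` is fixed by all of `Gal(ℍ′_n/K_n(i))`** (the B-locus reading).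
* §4 **`odd_of_galPt_genusPoint_ne_of_half_fixed`**: if moreover `g` fixes SOME half `Q₁` of the twisted generator
  (`φ_H(Q₁) = ι Θ_E(R)`) — which the halving lemma supplies for `g` trivial on `L_n(i)` (note §5, to be kernel-certified) —
  then **`𝓛(n)` is ODD** (hence `rank E_n(ℚ) = 1 = ord`, and BSD₂(E_n) iff `s(n) = 1`).
* §5 `galPt_genusPoint_ne_iff_galPt_genusPeriod_ne`: under the displayed recursion, if `g` fixes the recursion's lower
  terms then `g` moves `P(n)` iff it moves the genus period `Z(n)` — the hand-off to the transfer identity.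

What this buys the line: the UPPER HALF `4 ∤ 𝓛` of C⁺ and the rank-one criterion of the note are now kernel implications
from «a Galois element moves the genus point/period»; the existence of the mover is the class-field-theoretic 𝔭₂-law
(note §4; type tables note §6 / instruments `k3_layer1.py`: at k ≤ 3, n ≡ 5 (8), a mover exists EXACTLY when s(n) = 1).
Beyond-print theorem: NO at the kernel level (the mover is a hypothesis); BSD is not proved by any of this; no class is closed.

References: [cite: TianYuanZhang2017, Thm. 3.5 (p0011 L94–L100), Lemma 3.16 (p0017 L98–L113), Lemma 3.18 (p0017 L152–L153),
§3.1 (p0011 L53–L73)]; [cite: SilvermanAEC2009, III.4.5, X.4.9]; [cite: Darmon2004, Thm. 3.22] (GZK); tree: g3 `…LevelTwoHalfGenerator`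
(p665240), `…LevelTwoRhoValve` (p664829), g0 `…LevelTwoGenusPoint`, `Literature/…/IsogenyLocalPointsMaps` (`map_twoIsogenyPointsHom`),
`Literature/…/TianYuanZhang2017/CurveAFourTorsion`, `CMPointGaloisDisplays` (`galPt`), `Rank1Residual/P2/…SilentEvenFiveThetaFourTorsion`.
-/

noncomputable section

open scoped Classical

open WeierstrassCurve WeierstrassCurve.Affine Literature.NumberTheory.EllipticCurves
  Literature.NumberTheory.EllipticCurves.Rank1Residual Summit.BirchSwinnertonDyer.Rank1Residual
  Literature.NumberTheory.EllipticCurves.TianYuanZhang2017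
  Literature.NumberTheory.EllipticCurves.TianYuanZhang2017.W2
  Summit.BirchSwinnertonDyer.PrintCf2.LevelTwoHalfGenerator

set_option autoImplicit false

namespace Summit.BirchSwinnertonDyer.PrintCf2.GaloisMotion

variable {n : ℕ}

/-! ## §1 Torsion of `A(ℍ′_n)` is fixed by every automorphism fixing `i` (odd `n`) -/

/-- An automorphism fixing the coordinates of an affine point fixes the point. [folklore] -/
theorem galPt_some_eq_of_fixed (D : GenusPointData n) (g : D.H ≃ₐ[ℚ] D.H) {x y : D.H}
    (h : (curveA.baseChange D.H).toAffine.Nonsingular x y) (hx : g x = x) (hy : g y = y) :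
    D.galPt g (.some x y h) = .some x y h := by
  rw [GenusPointData.galPt, Point.map_some]
  congr 1

/-- **Lemma 3.18 ⟹ torsion is Galois-inert (odd `n`).** For ODD square-free `n`, every torsion point of `A(ℍ′_n)` lies in
`A[(1+i)³] = {O, (0,0), (±2i,0), (2,±4), (−2,±4i)}` (displayed `lemma318` + the explicit enumerations), so it is fixed by
every `g ∈ Aut_ℚ(ℍ′_n)` with `g(i) = i`. [cite: TianYuanZhang2017, Lemma 3.18 (p0017 L152–L153) and Lemma 3.16 (p0017 L98–L113)] -/
theorem galPt_eq_self_of_isOfFinAddOrder (D : GenusPointData n) (hodd : Odd n) (h318 : D.lemma318)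
    (g : D.H ≃ₐ[ℚ] D.H) (hgi : g D.im = D.im) {t : APoint D.H} (ht : IsOfFinAddOrder t) :
    D.galPt g t = t := by
  have hg2 : g (2 : D.H) = 2 := map_ofNat g 2
  have hg4 : g (4 : D.H) = 4 := map_ofNat g 4
  obtain ⟨-, h2⟩ := h318.1 hodd t ht
  rcases h2 with h0 | h1
  · rcases eq_of_two_nsmul_eq_zero D.im D.im_sq h0 with rfl | rfl | rfl | rfl
    · exact map_zero _
    · exact galPt_some_eq_of_fixed D g _ (map_zero g) (map_zero g)
    · exact galPt_some_eq_of_fixed D g _ (by rw [map_mul, hg2, hgi]) (map_zero g)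
    · exact galPt_some_eq_of_fixed D g _ (by rw [map_neg, map_mul, hg2, hgi]) (map_zero g)
  · rcases P2.ThetaDescent.eq_of_two_nsmul_eq_tauOne D.im D.im_sq t h1 with rfl | rfl | rfl | rfl
    · exact galPt_some_eq_of_fixed D g _ hg2 hg4
    · rw [map_neg]
      congr 1
      exact galPt_some_eq_of_fixed D g _ hg2 hg4
    · rw [tauHalf, cmI_some]
      exact galPt_some_eq_of_fixed D g _ (by rw [map_neg, hg2]) (by rw [map_mul, hgi, hg4])
    · rw [map_neg]
      congr 1
      rw [tauHalf, cmI_some]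
      exact galPt_some_eq_of_fixed D g _ (by rw [map_neg, hg2]) (by rw [map_mul, hgi, hg4])

/-! ## §2 A point whose `φ`-image comes from `K_n` has its double fixed by `Gal(ℍ′_n/K_n)` -/

/-- If `g(√−n) = √−n` then `g ∘ ι = ι` for the embedding `ι : K_n → ℍ′_n`. [folklore] -/
theorem algHom_comp_embK_eq (D : GenusPointData n) (hn : n ∈ n.divisors) (g : D.H ≃ₐ[ℚ] D.H)
    (hgK : g (D.sqrtNeg n) = D.sqrtNeg n) :
    (g : D.H →ₐ[ℚ] D.H).comp (D.embK n hn) = D.embK n hn := by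
  apply AdjoinRoot.algHom_ext
  have h1 : (D.embK n hn) (AdjoinRoot.root (genusFieldPoly n)) = D.sqrtNeg n := AdjoinRoot.liftAlgHom_root _ _ _ _
  show g ((D.embK n hn) (AdjoinRoot.root (genusFieldPoly n))) = (D.embK n hn) (AdjoinRoot.root (genusFieldPoly n))
  rw [h1, hgK]

/-- **`g` fixes `2·Q₁` whenever `φ_H(Q₁) = ι X` for a `K_n`-rational `X` and `g(√−n) = √−n`.** (`φ` is defined over `ℚ`,
so `φ_H(gQ₁) = g φ_H(Q₁) = φ_H(Q₁)`; hence `gQ₁ − Q₁ ∈ ker φ_H = {0, τ(1)}` is killed by `2`.)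
[cite: TianYuanZhang2017, §3.1 (p0011 L27–L36) and Lemma 3.16 (p0017 L105–L113)] [cite: SilvermanAEC2009, III.4.5] -/
theorem galPt_two_smul_half_eq (D : GenusPointData n) (hn : n ∈ n.divisors) (g : D.H ≃ₐ[ℚ] D.H)
    (hgK : g (D.sqrtNeg n) = D.sqrtNeg n) {Q₁ : APoint D.H} {X : A2Point (GenusField n)}
    (hQ₁ : φH D Q₁ = Point.map (W' := curveA.twoIsogenyCodomain) (D.embK n hn) X) :
    D.galPt g ((2 : ℤ) • Q₁) = (2 : ℤ) • Q₁ := by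
  have hφ : φH D (D.galPt g Q₁) = φH D Q₁ := by
    change curveA.twoIsogenyPointsHom D.H (Point.map (g : D.H →ₐ[ℚ] D.H) Q₁) = _
    rw [← map_twoIsogenyPointsHom]
    change Point.map (g : D.H →ₐ[ℚ] D.H) (φH D Q₁) = φH D Q₁
    rw [hQ₁, Point.map_map, algHom_comp_embK_eq D hn g hgK]
  have hker : φH D (D.galPt g Q₁ - Q₁) = 0 := by rw [map_sub, hφ, sub_self]
  have h2 : (2 : ℕ) • (D.galPt g Q₁ - Q₁) = 0 := by
    rcases (φH_eq_zero_iff D _).mp hker with h | h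
    · rw [h, smul_zero]
    · rw [h, two_nsmul_tauOne]
  have h2' : (2 : ℤ) • (D.galPt g Q₁ - Q₁) = 0 := by rw [ofNat_zsmul]; exact h2
  rw [map_zsmul]
  rw [smul_sub, sub_eq_zero] at h2'
  exact h2'

/-! ## §3 A Galois element moving the genus point forces `4 ∤ 𝓛(n)` -/

/-- **GALOIS MOTION ⟹ `4 ∤ 𝓛(n)`.**  Square-free ODD `n ≡ 5, 7 (mod 8)` with `ord_{s=1} L(E_n, s) = 1`; GZK; data `D` with
Thm 3.5's displayed main clause, integrality and Lemma 3.18.  If some `g ∈ Aut_ℚ(ℍ′_n)` with `g(i) = i` and `g(√−n) = √−n`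
satisfies `g·P(n) ≠ P(n)`, then `4 ∤ L` for every integer `L` with `𝓛(n)² = L²`.  (Proof: `2·P(n) ≡ ±𝓛(n)·Q₁` for a half
`Q₁` of the twisted generator; if `𝓛 = 4c` then `P(n) − (±c)·(2Q₁)` is torsion, and `2Q₁` and all torsion are `g`-fixed.)
[cite: TianYuanZhang2017, Thm. 3.5 (p0011 L94–L100), Lemma 3.18 (p0017 L152–L153)] [cite: Darmon2004, Thm. 3.22] -/
theorem not_four_dvd_of_galPt_genusPoint_ne
    (hGZK : rank_eq_analyticRank_of_analyticRank_le_one) (hsq : Squarefree n)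
    (h8 : n % 8 = 5 ∨ n % 8 = 7) (hr : (congruentNumberCurve n).analyticRank = 1)
    (D : GenusPointData n) (h35 : D.thm35Main) (hLs : D.scriptLSpec) (h318 : D.lemma318)
    (g : D.H ≃ₐ[ℚ] D.H) (hgi : g D.im = D.im) (hgK : g (D.sqrtNeg n) = D.sqrtNeg n)
    (hmove : D.galPt g (D.P n) ≠ D.P n) :
    ∀ L : ℤ, IsScriptL n L → ¬ (4 : ℤ) ∣ L := by
  haveI := isElliptic_congruentNumberCurve hsq.ne_zero
  have hodd : Odd n := by rcases h8 with h | h <;> exact Nat.odd_iff.mpr (by omega)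
  have hn : n ∈ n.divisors := Nat.mem_divisors_self n hsq.ne_zero
  have hn1 : 1 < n := by rcases h8 with h | h <;> omega
  have hLD : IsScriptL n (D.scriptL n) := hLs n hn hn1
  have hL0 : D.scriptL n ≠ 0 := (P2.bsdp_two_congruentNumberCurve_iff_of_isScriptL hGZK hsq hr hLD).2.2.1
  have hrank : (congruentNumberCurve n).mordellWeilRank = 1 := (hGZK _ hr.le).1.trans hr
  obtain ⟨R, hR⟩ := stub_S0 (n := n) hrank.le
  obtain ⟨Q₁, hQ₁⟩ := twist_halving hsq hn D R
  obtain ⟨u, hu, hrel⟩ := two_smul_genusPoint_sub_smul_half_isOfFinAddOrder hsq hrank.le D h35 hL0 hR hQ₁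
  intro L hL h4
  have h4' : (4 : ℤ) ∣ D.scriptL n := by
    rcases LevelTwo.eq_or_eq_neg_of_isScriptL hL hLD with e | e
    · rwa [← e]
    · rw [← dvd_neg, ← e]; exact h4
  obtain ⟨c, hc⟩ := h4'
  -- `2·(P − (u c)·(2Q₁))` is torsion, hence so is `t := P − (u c)·(2Q₁)`
  have ht : IsOfFinAddOrder (D.P n - (u * c) • ((2 : ℤ) • Q₁)) := by
    have e : (2 : ℤ) • D.P n - (u * D.scriptL n) • Q₁ = (2 : ℤ) • (D.P n - (u * c) • ((2 : ℤ) • Q₁)) := by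
      rw [hc]; module
    rw [e] at hrel
    exact LevelTwo.isOfFinAddOrder_of_zsmul two_ne_zero hrel
  apply hmove
  have eP : D.P n = (D.P n - (u * c) • ((2 : ℤ) • Q₁)) + (u * c) • ((2 : ℤ) • Q₁) := by abel
  have hV : D.galPt g ((u * c) • ((2 : ℤ) • Q₁)) = (u * c) • ((2 : ℤ) • Q₁) := by
    rw [map_zsmul, galPt_two_smul_half_eq D hn g hgK hQ₁]
  rw [eP, map_add, galPt_eq_self_of_isOfFinAddOrder D hodd h318 g hgi ht, hV]

/-- **`4 ∣ 𝓛(n)` ⟹ the genus point is fixed by `Gal(ℍ′_n/K_n(i))`** (contrapositive of the previous theorem): on the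
square-free odd `n ≡ 5, 7 (mod 8)` of analytic rank one with `4 ∣ 𝓛(n)` (the census B-locus `Ш ≅ (ℤ/4)²` and deeper),
`g·P(n) = P(n)` for every `g ∈ Aut_ℚ(ℍ′_n)` fixing `i` and `√−n`.
[cite: TianYuanZhang2017, Thm. 3.5 (p0011 L94–L100), Lemma 3.18 (p0017 L152–L153)] [cite: Darmon2004, Thm. 3.22] -/
theorem galPt_genusPoint_eq_of_four_dvd
    (hGZK : rank_eq_analyticRank_of_analyticRank_le_one) (hsq : Squarefree n)
    (h8 : n % 8 = 5 ∨ n % 8 = 7) (hr : (congruentNumberCurve n).analyticRank = 1)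
    (D : GenusPointData n) (h35 : D.thm35Main) (hLs : D.scriptLSpec) (h318 : D.lemma318)
    {L : ℤ} (hL : IsScriptL n L) (h4 : (4 : ℤ) ∣ L)
    (g : D.H ≃ₐ[ℚ] D.H) (hgi : g D.im = D.im) (hgK : g (D.sqrtNeg n) = D.sqrtNeg n) :
    D.galPt g (D.P n) = D.P n := by
  by_contra hne
  exact not_four_dvd_of_galPt_genusPoint_ne hGZK hsq h8 hr D h35 hLs h318 g hgi hgK hne L hL h4

/-! ## §4 … and if the mover fixes a half of the generator, `𝓛(n)` is odd -/

/-- **GALOIS MOTION + A FIXED HALF ⟹ `𝓛(n)` ODD.**  Same setting; `R` a generator of `E_n(ℚ)` modulo torsion and `Q₁ ∈ A(ℍ′_n)`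
a half of its twist (`φ_H(Q₁) = ι Θ_E(R)`) which is FIXED by `g` (the halving lemma gives such a half rational over
`L_n(i)`, hence fixed by every `g` trivial on `L_n(i)`).  If `g·P(n) ≠ P(n)` then `𝓛(n)` is odd: `¬ 2 ∣ L` whenever
`𝓛(n)² = L²`.  (If `𝓛 = 2c` then `P(n) − (±c)·Q₁` is torsion and `g`-fixed.)  With `s(n) = 1` this is BSD₂(E_n) through the
level-two door; it is the kernel form of the note's rank-one criterion §5.2.
[cite: TianYuanZhang2017, Thm. 3.5 (p0011 L94–L100), Lemma 3.18 (p0017 L152–L153)] [cite: Darmon2004, Thm. 3.22] -/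
theorem not_two_dvd_of_galPt_genusPoint_ne_of_half_fixed
    (hGZK : rank_eq_analyticRank_of_analyticRank_le_one) (hsq : Squarefree n)
    (h8 : n % 8 = 5 ∨ n % 8 = 7) (hr : (congruentNumberCurve n).analyticRank = 1)
    (D : GenusPointData n) (h35 : D.thm35Main) (hLs : D.scriptLSpec) (h318 : D.lemma318)
    {R : (congruentNumberCurve n).toAffine.Point} (hR : ∀ x, ∃ k : ℤ, IsOfFinAddOrder (x - k • R))
    {Q₁ : APoint D.H} (hQ₁ : φH D Q₁ = Point.map (W' := curveA.twoIsogenyCodomain)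
      (D.embK n (Nat.mem_divisors_self n hsq.ne_zero)) (ΘE hsq.ne_zero R))
    (g : D.H ≃ₐ[ℚ] D.H) (hgi : g D.im = D.im) (hfix : D.galPt g Q₁ = Q₁)
    (hmove : D.galPt g (D.P n) ≠ D.P n) :
    ∀ L : ℤ, IsScriptL n L → ¬ (2 : ℤ) ∣ L := by
  haveI := isElliptic_congruentNumberCurve hsq.ne_zero
  have hodd : Odd n := by rcases h8 with h | h <;> exact Nat.odd_iff.mpr (by omega)
  have hn : n ∈ n.divisors := Nat.mem_divisors_self n hsq.ne_zero
  have hn1 : 1 < n := by rcases h8 with h | h <;> omega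
  have hLD : IsScriptL n (D.scriptL n) := hLs n hn hn1
  have hL0 : D.scriptL n ≠ 0 := (P2.bsdp_two_congruentNumberCurve_iff_of_isScriptL hGZK hsq hr hLD).2.2.1
  have hrank : (congruentNumberCurve n).mordellWeilRank = 1 := (hGZK _ hr.le).1.trans hr
  obtain ⟨u, hu, hrel⟩ := two_smul_genusPoint_sub_smul_half_isOfFinAddOrder hsq hrank.le D h35 hL0 hR hQ₁
  intro L hL h2
  have h2' : (2 : ℤ) ∣ D.scriptL n := by
    rcases LevelTwo.eq_or_eq_neg_of_isScriptL hL hLD with e | e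
    · rwa [← e]
    · rw [← dvd_neg, ← e]; exact h2
  obtain ⟨c, hc⟩ := h2'
  have ht : IsOfFinAddOrder (D.P n - (u * c) • Q₁) := by
    have e : (2 : ℤ) • D.P n - (u * D.scriptL n) • Q₁ = (2 : ℤ) • (D.P n - (u * c) • Q₁) := by
      rw [hc]; module
    rw [e] at hrel
    exact LevelTwo.isOfFinAddOrder_of_zsmul two_ne_zero hrel
  apply hmove
  have eP : D.P n = (D.P n - (u * c) • Q₁) + (u * c) • Q₁ := by abel
  rw [eP, map_add, map_zsmul, galPt_eq_self_of_isOfFinAddOrder D hodd h318 g hgi ht, hfix]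

/-! ## §5 Hand-off to the genus period: a mover of `Z(n)` fixing the recursion's lower terms moves `P(n)` -/

/-- **`g` moves `P(n)` iff `g` moves `Z(n)`, once `g` fixes the lower terms of the recursion** `P(n) = Z(n) − Σ_{d₀} ε·𝓛(n/d₀)·P(d₀)`
(displayed `GenusPointData.recursion`).  This is where the transfer identity (`…GenusPeriodTransfer`: `α·Z(n) = Z(n) +
[α^{g(n)} = σ]·τ(1)`) plugs in. [cite: TianYuanZhang2017, §3.1 (p0011 L67–L73)] -/
theorem galPt_genusPoint_ne_iff_galPt_genusPeriod_ne (D : GenusPointData n) (hrec : D.recursion)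
    (hn : n ∈ n.divisors) (h8 : n % 8 = 5 ∨ n % 8 = 6 ∨ n % 8 = 7) (g : D.H ≃ₐ[ℚ] D.H)
    (hfixLower : D.galPt g (∑ d₀ ∈ recursionIndex n,
        cmIPow D.im D.im_sq (D.eps d₀ (n / d₀)) (D.scriptL (n / d₀) • D.P d₀)) =
      ∑ d₀ ∈ recursionIndex n, cmIPow D.im D.im_sq (D.eps d₀ (n / d₀)) (D.scriptL (n / d₀) • D.P d₀)) :
    D.galPt g (D.P n) ≠ D.P n ↔ D.galPt g (D.Z n) ≠ D.Z n := by
  have hP := hrec n hn h8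
  constructor
  · intro hP' hZ
    apply hP'
    rw [hP, map_sub, hZ, hfixLower]
  · intro hZ' hP'
    apply hZ'
    have eZ : D.Z n = D.P n + ∑ d₀ ∈ recursionIndex n,
        cmIPow D.im D.im_sq (D.eps d₀ (n / d₀)) (D.scriptL (n / d₀) • D.P d₀) := by
      rw [hP]; abel
    rw [eZ, map_add, hP', hfixLower]

end Summit.BirchSwinnertonDyer.PrintCf2.GaloisMotion

end
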